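import Literature.Combinatorics.SimpleGraph.HarmonicOneForms
import Literature.Combinatorics.SimpleGraph.FlowSpace
import HarnessLib

/-!
# B–N's flows `H¹(G, A)` on directed edges = the flow space `{x : Dx = 0}` of any orientation;
# `dim 𝓗¹(G) = g` (Baker–Norine 2009, §4.3; Godsil–Royle Thm 14.2.1 / Biggs Thm 4.5)

Source (held, read at the page; statements VERBATIM). M. Baker, S. Norine, *Harmonic morphisms
and hyperelliptic graphs*, Int. Math. Res. Not. IMRN 2009 [BakerNorine2009] (held text
`paper:arxiv-0707.1309`, chunk p0014), §4.3: «An `A`-flow (or simply a flow if `A = ℝ`) on `G` is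
a 1-cochain `ω ∈ C¹(G, A)` such that `δ(ω) = 0`. We denote by `H¹(G, A)` the space of `A`-flows
on `G`. When `A = ℝ`, we will also refer to `𝓗¹(G) := H¹(G, ℝ)` as the space of harmonic 1-forms
on `G`; it is analogous to the space `Ω¹(X)` of holomorphic 1-forms on a Riemann surface `X`. For
example, it is well-known that `dim_ℝ 𝓗¹(G) = g` (just as `dim_ℂ Ω¹(X) = g` in the Riemann
surface case).» The «well-known» dimension count is Godsil–Royle, *Algebraic Graph Theory*,
Thm 14.2.1 / Biggs, *Algebraic Graph Theory*, Thm 4.5 — the tree's `Orientation.finrank_flowSpace`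
(`FlowSpace.lean`): the flow space `{x : Dx = 0}` of an oriented graph has dimension
`m − n + c`.

## What is formalised (vocabulary: `IsOneCochain`, `coboundary`, `IsGraphFlow` of
## `HarmonicOneForms`; `σ : Orientation G`, `σ.incMatrix R`, `σ.flowSpace R` of
## `OrientedIncidenceMatrix` / `FlowSpace`; `corank`, `genus`)

* `edgeVec σ ω` (read a 1-cochain on the edge `e` oriented `tail(e) → head(e)`) and
  `ofEdgeVec σ x` (the 1-cochain of an edge vector), mutually inverse on 1-cochains;
* **`δ = D`**: `IsOneCochain.coboundary_eq_incMatrix_mulVec` (`δ(ω)(u) = (D x)_u`, B–N's (4.2)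
  is Kirchhoff's law of GR §14.2), hence `IsOneCochain.isGraphFlow_iff_mem_flowSpace` and
  `mem_flowSpace_iff_isGraphFlow`;
* the spaces `cochainSubmodule G R A = C¹(G, A)`, `flowSubmodule G R A = H¹(G, A)` and the
  linear equivalence `flowSubmoduleEquiv σ R : H¹(G, R) ≃ σ.flowSpace R`;
* **«`dim 𝓗¹(G) = g`»**: `finrank_flowSubmodule` (`= corank G` over any field) and, for a
  connected graph, `genus_eq_corank`, `finrank_flowSubmodule_eq_genus`.

Definitions with bodies and theorems; no `sorry`; no named facts; no instances.
-/

open Finset SimpleGraph Matrix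
open Literature.Combinatorics.SimpleGraph.ChipFiring
open Literature.Combinatorics.SimpleGraph.OrientedIncidence
open Literature.Combinatorics.SimpleGraph.ElementaryGraphSachs

namespace Literature.Combinatorics.SimpleGraph.BakerNorine

variable {V : Type*} [Fintype V] [DecidableEq V] {G : SimpleGraph V} [DecidableRel G.Adj]
variable (σ : Orientation G) {A : Type*} [AddCommGroup A]

/-! ### §1 Reading a 1-cochain along an orientation -/

/-- The edge vector of a 1-cochain for the orientation `σ`: on the edge `e`, the value of `ω` on
the directed edge `tail(e) → head(e)` (B–N's `t(e) = head`).
[cite: BakerNorine2009, §4.3 (1-cochains «`ω : E⃗(G) → A` with `ω(e) = −ω(ē)`»)] -/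
noncomputable def edgeVec (ω : V → V → A) : G.edgeSet → A := fun e => ω (σ.tail e) (σ.head e)

/-- The 1-cochain of an edge vector for the orientation `σ`: `x(e)` on `tail(e) → head(e)`,
`−x(e)` on the reversed dart, `0` off the edges. [cite: BakerNorine2009, §4.3] -/
noncomputable def ofEdgeVec (x : G.edgeSet → A) : V → V → A := fun u v =>
  if h : G.Adj u v then
    (if σ.head ⟨s(u, v), h⟩ = v then x ⟨s(u, v), h⟩ else -x ⟨s(u, v), h⟩)
  else 0

omit [Fintype V] [DecidableEq V] [DecidableRel G.Adj] [AddCommGroup A] in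
/-- Unfolding `edgeVec`. [cite: BakerNorine2009, §4.3] -/
theorem edgeVec_apply (ω : V → V → A) (e : G.edgeSet) :
    edgeVec σ ω e = ω (σ.tail e) (σ.head e) := rfl

omit [Fintype V] in
/-- `ofEdgeVec` on a dart running with the orientation. [cite: BakerNorine2009, §4.3] -/
theorem ofEdgeVec_apply_of_head_eq (x : G.edgeSet → A) {u v : V} (h : G.Adj u v)
    (hh : σ.head ⟨s(u, v), h⟩ = v) : ofEdgeVec σ x u v = x ⟨s(u, v), h⟩ := by
  unfold ofEdgeVec
  rw [dif_pos h, if_pos hh]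

omit [Fintype V] in
/-- `ofEdgeVec` on a dart running against the orientation. [cite: BakerNorine2009, §4.3] -/
theorem ofEdgeVec_apply_of_head_ne (x : G.edgeSet → A) {u v : V} (h : G.Adj u v)
    (hh : σ.head ⟨s(u, v), h⟩ ≠ v) : ofEdgeVec σ x u v = -x ⟨s(u, v), h⟩ := by
  unfold ofEdgeVec
  rw [dif_pos h, if_neg hh]

omit [Fintype V] in
/-- `ofEdgeVec` vanishes off the edges. [cite: BakerNorine2009, §4.3] -/
theorem ofEdgeVec_apply_of_not_adj (x : G.edgeSet → A) {u v : V} (h : ¬G.Adj u v) :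
    ofEdgeVec σ x u v = 0 := by
  unfold ofEdgeVec
  rw [dif_neg h]

omit [Fintype V] [DecidableEq V] [DecidableRel G.Adj] in
/-- The two darts of an edge name the same element of `G.edgeSet`. [cite: BakerNorine2009, §4.3
(«`ē` the directed edge representing the same undirected edge as `e`»)] -/
theorem edge_swap {u v : V} (h : G.Adj u v) :
    (⟨s(v, u), h.symm⟩ : G.edgeSet) = ⟨s(u, v), h⟩ :=
  Subtype.ext Sym2.eq_swap

omit [Fintype V] in
/-- `ofEdgeVec σ x` is a 1-cochain. [cite: BakerNorine2009, §4.3] -/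
theorem isOneCochain_ofEdgeVec (x : G.edgeSet → A) : IsOneCochain G (ofEdgeVec σ x) where
  antisymm' := fun u v => by
    by_cases h : G.Adj u v
    · rcases σ.head_tail_of_adj h with ⟨hu, _⟩ | ⟨hv, _⟩
      · rw [ofEdgeVec_apply_of_head_ne σ x h (by rw [hu]; exact h.ne),
          ofEdgeVec_apply_of_head_eq σ x h.symm (by rw [edge_swap h]; exact hu), edge_swap h,
          neg_neg]
      · rw [ofEdgeVec_apply_of_head_eq σ x h hv,
          ofEdgeVec_apply_of_head_ne σ x h.symm (by rw [edge_swap h, hv]; exact h.ne.symm),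
          edge_swap h]
    · rw [ofEdgeVec_apply_of_not_adj σ x h, ofEdgeVec_apply_of_not_adj σ x (fun h' => h h'.symm),
        neg_zero]
  eq_zero_of_not_adj := fun _ _ h => ofEdgeVec_apply_of_not_adj σ x h

omit [Fintype V] in
/-- `edgeVec σ (ofEdgeVec σ x) = x`. [cite: BakerNorine2009, §4.3] -/
theorem edgeVec_ofEdgeVec (x : G.edgeSet → A) : edgeVec σ (ofEdgeVec σ x) = x := by
  funext e
  have he : (⟨s(σ.tail e, σ.head e), (σ.adj_head_tail e).symm⟩ : G.edgeSet) = e :=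
    Subtype.ext (Sym2.eq_swap.trans (σ.mk_head_tail e))
  rw [edgeVec_apply, ofEdgeVec_apply_of_head_eq σ x (σ.adj_head_tail e).symm (by rw [he]), he]

omit [Fintype V] in
/-- `ofEdgeVec σ (edgeVec σ ω) = ω` for a 1-cochain `ω`. [cite: BakerNorine2009, §4.3] -/
theorem IsOneCochain.ofEdgeVec_edgeVec {ω : V → V → A} (h : IsOneCochain G ω) :
    ofEdgeVec σ (edgeVec σ ω) = ω := by
  funext u v
  by_cases huv : G.Adj u v
  · rcases σ.head_tail_of_adj huv with ⟨hu, hv⟩ | ⟨hv, hu⟩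
    · rw [ofEdgeVec_apply_of_head_ne σ _ huv (by rw [hu]; exact huv.ne), edgeVec_apply, hu, hv,
        h.antisymm' u v, neg_neg]
    · rw [ofEdgeVec_apply_of_head_eq σ _ huv hv, edgeVec_apply, hv, hu]
  · rw [ofEdgeVec_apply_of_not_adj σ _ huv, h.eq_zero_of_not_adj huv]

/-! ### §2 `δ` is the incidence mapping `D` -/

omit [Fintype V] [DecidableRel G.Adj] in
/-- The summand of `(Dx)_u` at the edge `uv` is `ω(v, u)`. [cite: BakerNorine2009, §4.3
(eq. (4.2))] -/
private theorem ite_sub_ite_eq {R : Type*} [CommRing R] {ω : V → V → R} (h : IsOneCochain G ω)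
    {u v : V} (e : G.edgeSet) (he : s(u, v) = (e : Sym2 V)) :
    ((if σ.head e = u then edgeVec σ ω e else 0) - (if σ.tail e = u then edgeVec σ ω e else 0)) =
      ω v u := by
  have huv : G.Adj u v := by
    have h2 := e.2
    rw [← he] at h2
    exact h2
  have hee : e = ⟨s(u, v), huv⟩ := Subtype.ext he.symm
  subst hee
  rcases σ.head_tail_of_adj huv with ⟨hh, ht⟩ | ⟨hh, ht⟩
  · rw [if_pos hh, if_neg (by rw [ht]; exact huv.ne.symm), sub_zero, edgeVec_apply, hh, ht]
  · rw [if_neg (by rw [hh]; exact huv.ne.symm), if_pos ht, zero_sub, edgeVec_apply, hh, ht,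
      h.antisymm' v u, neg_neg]

/-- **`δ(ω) = D x`**: B–N's coboundary (4.2) of a 1-cochain is the incidence (boundary) mapping of
Godsil–Royle / Biggs applied to its edge vector, for any orientation.
[cite: BakerNorine2009, §4.3 (eq. (4.2))] -/
theorem IsOneCochain.coboundary_eq_incMatrix_mulVec {R : Type*} [CommRing R] {ω : V → V → R}
    (h : IsOneCochain G ω) (u : V) : coboundary G ω u = (σ.incMatrix R *ᵥ edgeVec σ ω) u := by
  rw [σ.mulVec_incMatrix, coboundary_apply, sum_filter, sum_filter, ← sum_sub_distrib]
  symm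
  calc ∑ e, ((if σ.head e = u then edgeVec σ ω e else 0) -
          (if σ.tail e = u then edgeVec σ ω e else 0))
      = ∑ e ∈ univ.filter (fun e : G.edgeSet => u ∈ (e : Sym2 V)),
          ((if σ.head e = u then edgeVec σ ω e else 0) -
            (if σ.tail e = u then edgeVec σ ω e else 0)) := by
        refine (sum_subset (filter_subset _ _) fun e _ he => ?_).symm
        have hu : u ∉ (e : Sym2 V) := fun h' => he (mem_filter.2 ⟨mem_univ _, h'⟩)
        rw [if_neg (fun h' : σ.head e = u => hu (h' ▸ σ.head_mem e)),
          if_neg (fun h' : σ.tail e = u => hu (h' ▸ σ.tail_mem e)), sub_zero]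
    _ = ∑ v ∈ G.neighborFinset u, ω v u := by
        refine sum_bij' (fun e he => Sym2.Mem.other (mem_filter.1 he).2)
          (fun v hv => ⟨s(u, v), (mem_neighborFinset _ _ _).1 hv⟩) (fun e he => ?_)
          (fun v hv => ?_) (fun e he => ?_) (fun v hv => ?_) (fun e he => ?_)
        · rw [mem_neighborFinset, ← mem_edgeSet, Sym2.other_spec]
          exact e.2
        · exact mem_filter.2 ⟨mem_univ _, Sym2.mem_mk_left u v⟩
        · exact Subtype.ext (Sym2.other_spec _)
        · exact Sym2.congr_right.1 (Sym2.other_spec _)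
        · exact ite_sub_ite_eq σ h e (Sym2.other_spec _)

/-- **B–N's flows are the flow space**: a 1-cochain is an `A`-flow iff its edge vector lies in
`{x : Dx = 0}` (for any orientation). [cite: BakerNorine2009, §4.3 («`H¹(G, A)`»)] -/
theorem IsOneCochain.isGraphFlow_iff_mem_flowSpace {R : Type*} [CommRing R] {ω : V → V → R}
    (h : IsOneCochain G ω) : IsGraphFlow G ω ↔ edgeVec σ ω ∈ σ.flowSpace R := by
  rw [σ.mem_flowSpace_iff R]
  constructor
  · intro hf
    funext u
    rw [← h.coboundary_eq_incMatrix_mulVec σ u, hf.coboundary_eq_zero, Pi.zero_apply]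
  · intro h0
    exact ⟨h, fun u => by rw [h.coboundary_eq_incMatrix_mulVec σ u, h0, Pi.zero_apply]⟩

/-- Conversely an edge vector is in the flow space iff its 1-cochain is a flow.
[cite: BakerNorine2009, §4.3 («`H¹(G, A)`»)] -/
theorem mem_flowSpace_iff_isGraphFlow {R : Type*} [CommRing R] (x : G.edgeSet → R) :
    x ∈ σ.flowSpace R ↔ IsGraphFlow G (ofEdgeVec σ x) := by
  rw [(isOneCochain_ofEdgeVec σ x).isGraphFlow_iff_mem_flowSpace σ, edgeVec_ofEdgeVec]

/-! ### §3 The spaces `C¹(G, A)`, `H¹(G, A)` and `dim 𝓗¹(G) = g` -/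

variable (G)

/-- **`C¹(G, A)`**, «the space of 1-cochains on `G` with values in `A`», as a submodule of
`V → V → A`. [cite: BakerNorine2009, §4.3] -/
def cochainSubmodule (R A : Type*) [Semiring R] [AddCommGroup A] [Module R A] :
    Submodule R (V → V → A) where
  carrier := {ω | IsOneCochain G ω}
  add_mem' := fun h₁ h₂ => h₁.add h₂
  zero_mem' := isOneCochain_zero
  smul_mem' := fun c _ h => h.smul c

/-- **`H¹(G, A)`**, «the space of `A`-flows on `G`». [cite: BakerNorine2009, §4.3] -/
def flowSubmodule (R A : Type*) [Semiring R] [AddCommGroup A] [Module R A] :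
    Submodule R (V → V → A) where
  carrier := {ω | IsGraphFlow G ω}
  add_mem' := fun h₁ h₂ => h₁.add h₂
  zero_mem' := isGraphFlow_zero
  smul_mem' := fun c _ h => h.smul c

omit [Fintype V] [DecidableEq V] [DecidableRel G.Adj] in
/-- Membership in `C¹(G, A)`. [cite: BakerNorine2009, §4.3] -/
theorem mem_cochainSubmodule {R A : Type*} [Semiring R] [AddCommGroup A] [Module R A]
    {ω : V → V → A} : ω ∈ cochainSubmodule G R A ↔ IsOneCochain G ω := Iff.rfl

omit [DecidableEq V] in
/-- Membership in `H¹(G, A)`. [cite: BakerNorine2009, §4.3] -/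
theorem mem_flowSubmodule {R A : Type*} [Semiring R] [AddCommGroup A] [Module R A]
    {ω : V → V → A} : ω ∈ flowSubmodule G R A ↔ IsGraphFlow G ω := Iff.rfl

omit [DecidableEq V] in
/-- `H¹(G, A) ≤ C¹(G, A)`. [cite: BakerNorine2009, §4.3] -/
theorem flowSubmodule_le_cochainSubmodule {R A : Type*} [Semiring R] [AddCommGroup A]
    [Module R A] : flowSubmodule G R A ≤ cochainSubmodule G R A :=
  fun _ h => h.toIsOneCochain

variable {G}

/-- **`H¹(G, R) ≅` the flow space** `{x : Dx = 0}` of the orientation `σ`, `R`-linearly (read a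
flow along `σ`). [cite: BakerNorine2009, §4.3 («`𝓗¹(G)` […] it is well-known that
`dim_ℝ 𝓗¹(G) = g`»)] -/
noncomputable def flowSubmoduleEquiv (R : Type*) [CommRing R] :
    flowSubmodule G R R ≃ₗ[R] σ.flowSpace R where
  toFun ω := ⟨edgeVec σ ω.1, (ω.2.toIsOneCochain.isGraphFlow_iff_mem_flowSpace σ).1 ω.2⟩
  invFun x := ⟨ofEdgeVec σ x.1, (mem_flowSpace_iff_isGraphFlow σ x.1).1 x.2⟩
  map_add' := fun _ _ => by
    ext e
    rfl
  map_smul' := fun _ _ => by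
    ext e
    rfl
  left_inv := fun ω => Subtype.ext (ω.2.toIsOneCochain.ofEdgeVec_edgeVec σ)
  right_inv := fun x => Subtype.ext (edgeVec_ofEdgeVec σ x.1)

/-- `flowSubmoduleEquiv` reads the flow along `σ`. [cite: BakerNorine2009, §4.3] -/
theorem flowEquiv_apply (R : Type*) [CommRing R] (ω : flowSubmodule G R R) :
    (flowSubmoduleEquiv σ R ω : G.edgeSet → R) = edgeVec σ ω.1 := rfl

/-- **«`dim 𝓗¹(G) = g`», first form**: over any field, `dim H¹(G, K) = m − n + c`, the co-rank
(Godsil–Royle Thm 14.2.1 / Biggs Thm 4.5 through `flowSubmoduleEquiv`). [cite: BakerNorine2009, §4.3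
(«it is well-known that `dim_ℝ 𝓗¹(G) = g`»)] -/
theorem finrank_flowSubmodule (K : Type*) [Field K] :
    Module.finrank K (flowSubmodule G K K) = corank G := by
  rw [LinearEquiv.finrank_eq (flowSubmoduleEquiv (someOrientation G) K),
    Orientation.finrank_flowSpace]

omit [DecidableEq V] in
/-- For a connected graph the co-rank `m − n + 1` is the genus `g = |E| − |V| + 1`.
[cite: BakerNorine2009, §1.3 («`g = |E(G)| − |V(G)| + 1` is the genus»)] -/
theorem genus_eq_corank (hG : G.Connected) : genus G = corank G := by
  haveI : Nonempty V := hG.nonempty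
  haveI : Subsingleton G.ConnectedComponent := hG.preconnected.subsingleton_connectedComponent
  have hcc : Nat.card G.ConnectedComponent = 1 :=
    Nat.card_of_subsingleton (G.connectedComponentMk (Classical.arbitrary V))
  have hle := hG.card_vert_le_card_edgeSet_add_one
  rw [Nat.card_eq_fintype_card, Nat.card_eq_fintype_card] at hle
  rw [genus_eq, corank, hcc, Set.ncard_eq_toFinset_card', Set.toFinset_card,
    Nat.card_eq_fintype_card, edgeFinset_card]
  omega

/-- **«`dim_ℝ 𝓗¹(G) = g`»** for a connected graph, over any field. [cite: BakerNorine2009, §4.3] -/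
theorem finrank_flowSubmodule_eq_genus (K : Type*) [Field K] (hG : G.Connected) :
    (Module.finrank K (flowSubmodule G K K) : ℤ) = genus G := by
  rw [finrank_flowSubmodule, genus_eq_corank hG]

end Literature.Combinatorics.SimpleGraph.BakerNorine
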